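import Summits.ValiantsHypothesis.ValiantsHypothesis.Theorems.KPlusLogSqLawTropicalBMarkedEdgeCoreQCoverLaw
import Summits.ValiantsHypothesis.ValiantsHypothesis.Theorems.KPlusLogSqLawTropicalBMarkedEdgeCoreFourUnion

/-!
# Route «KPlusLogSqLaw», crux `TropicalB` (stmt-ValiantsHypothesis-19771) — MARKED-EDGE sector, NESTED-TRIANGLE CORE, ALL sizes:
# `law_of_coverZ_BC/BE` — the Z-DOUBLED template: next to the Q-cover, ONE cover inside `σB⊎σY⊎σZ⊎σZ` using the loop at `b3` and
# one of the loops at `b1`, `b2` kills the realisation; `nestedTriangle_false_of_covers_or_coversZ` — the law modulo the located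
# dichotomy «Y-doubled non-trivial cover OR Z-doubled (b3 ∧ (b1 ∨ b2))-cover» for every Q-cover

HONEST FRAMING.  Helper file (cell `pub-symmetroid`, seat val-sym-trop-p4 (g20), 2026-08-29; `--supports stmt-ValiantsHypothesis-19771 --as
helper`).  LOCATED by this seat (memo PCD-DICHOTOMY-g20): the hypotheses of `nestedTriangle_false_of_covers` (p683081: EVERY Q₁₈-cover admits
a compatible cover of `σB⊎σC⊎σC⊎σZ` with a non-trivial marked pattern) do NOT follow from the kernel lemma list — in kernel-valid permutation
systems ≈ 0.5 % of the Q-covers are «rigid» (m = 8, 9, 10; only the three trivial patterns occur).  For EVERY such rigid Q-cover a second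
template applies (0 exceptions among ≈ 130 000 Q-covers of ≈ 110 000 kernel-valid systems, m ≤ 10): with `σZ` doubled instead of `σY`,
`σB ⊎ σY ⊎ σZ ⊎ σZ = T ⊎ P ⊎ N₂ ⊎ N₃` where `P` uses the loop at `b3` and one of the loops at `b1`, `b2`.  THIS FILE proves the numerical
half of that template (Abel/Karamata with the repeated top parameter, `FourBit.four_factors_eq_le`): such a `P` contradicts realisability
(`law_of_coverZ_BC`, `law_of_coverZ_BE`), and restates the all-m nested-triangle law modulo the located dichotomy
(`nestedTriangle_false_of_covers_or_coversZ`).  The EXISTENCE half (the dichotomy itself) is OPEN.  Nothing here proves the law; nothing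
concerns `TropicalB` in its window, `WeakLifting`, the doors, `MatrixDescartes` (stmt-ValiantsHypothesis-18050) or VP ≠ VNP.
-/

set_option linter.dupNamespace false
set_option autoImplicit false

namespace Summit.ValiantsHypothesis.ValiantsHypothesis.Theorems.KPlusLogSqLaw
namespace MarkedEdge
namespace Core

open Finset

variable {V : Type*} [Fintype V] [DecidableEq V]

omit [Fintype V] [DecidableEq V] in
/-- reorder: `[a, c, d, e] → [c, d, a, e]` (move the first of four to the third place). [folklore] -/
theorem mv13 {a c d e : V} {l : List V} (h : List.Perm [a, c, d, e] l) : List.Perm [c, d, a, e] l := by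
  have : List.Perm [c, d, a, e] [a, c, d, e] :=
    ((List.Perm.swap a d [e]).cons c).trans (List.Perm.swap a c [d, e])
  exact this.trans h

omit [Fintype V] [DecidableEq V] in
/-- reorder: `[a, c, d, e] → [d, a, c, e]` (move the third of four to the front). [folklore] -/
theorem mv31 {a c d e : V} {l : List V} (h : List.Perm [a, c, d, e] l) : List.Perm [d, a, c, e] l :=
  sw12 (perm4_swap12 h)

section Core

variable (ok : V → V → Prop) (w g : V → V → ℤ) (b : Fin 5 → V)

/-- The slope of a cover is a non-negative quantity (a sum of loop weights `2^l`). [this seat's lemma] -/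
theorem slope_nonneg (hb : Function.Injective b)
    (hoff : ∀ i j, j ≠ i → g i j = 0) (hmark : ∀ l, g (b l) (b l) = (2 : ℤ) ^ (l : ℕ)) (haux : ∀ i, (∀ l, b l ≠ i) → g i i = 0)
    (X : Equiv.Perm V) : 0 ≤ ∑ i, g i (X i) := by
  rw [slope_eq_sum_marked g b hb hoff hmark haux X, Fin.sum_univ_five]
  by_cases c0 : X (b 0) = b 0 <;> by_cases c1 : X (b 1) = b 1 <;> by_cases c2 : X (b 2) = b 2 <;>
    by_cases c3 : X (b 3) = b 3 <;> by_cases c4 : X (b 4) = b 4 <;> simp [c0, c1, c2, c3, c4]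

/-- **`law_of_coverZ_BC`** (Z-doubled template, pair (B,C)).  In a realisation, let `T` be a cover using the loops at `b1` and `b4`
but not the loop at `b0` (slope ≥ 18, e.g. the Q₁₈ of `core_S3`), and `P` a cover such that `[T i, P i, p i, q i]` rearranges
`[σB i, σC i, σZ i, σZ i]` at every node for some maps `p, q`.  Then `P` does not use the loop at `b3` together with one of the loops
at `b1`, `b2`.  (Complete `p, q` to covers by Hall (`complete_two`); exactly one of the three remaining covers uses the second loop at
`b4`, hence has slope ≥ 16; with `s(P) ≥ 10` the factor slopes dominate the suffix sums `17, 34, 44` of the maximiser slopes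
`(6,10,17,17)`, so `four_factors_eq_le` (weakly increasing parameters `θB ≤ θC ≤ θZ ≤ θZ`) forces `T = σZ`, absurd.) [this seat's theorem] -/
theorem law_of_coverZ_BC (hb : Function.Injective b)
    (hoff : ∀ i j, j ≠ i → g i j = 0) (hmark : ∀ l, g (b l) (b l) = (2 : ℤ) ^ (l : ℕ)) (haux : ∀ i, (∀ l, b l ≠ i) → g i i = 0)
    {θB θC θZ : ℤ} {σB σC σZ : Equiv.Perm V} (hBC : θB < θC) (hCZ : θC < θZ)
    (hB : (∀ i, ok i (σB i)) ∧ ∀ τ : Equiv.Perm V, τ ≠ σB → (∀ i, ok i (τ i)) →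
      ∑ i, (w i (τ i) + θB * g i (τ i)) < ∑ i, (w i (σB i) + θB * g i (σB i)))
    (hC : (∀ i, ok i (σC i)) ∧ ∀ τ : Equiv.Perm V, τ ≠ σC → (∀ i, ok i (τ i)) →
      ∑ i, (w i (τ i) + θC * g i (τ i)) < ∑ i, (w i (σC i) + θC * g i (σC i)))
    (hZ : (∀ i, ok i (σZ i)) ∧ ∀ τ : Equiv.Perm V, τ ≠ σZ → (∀ i, ok i (τ i)) →
      ∑ i, (w i (τ i) + θZ * g i (τ i)) < ∑ i, (w i (σZ i) + θZ * g i (σZ i)))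
    (hB0 : σB (b 0) ≠ b 0) (hB1 : σB (b 1) = b 1) (hB2 : σB (b 2) = b 2) (hB3 : σB (b 3) ≠ b 3) (hB4 : σB (b 4) ≠ b 4)
    (hC0 : σC (b 0) ≠ b 0) (hC1 : σC (b 1) = b 1) (hC2 : σC (b 2) ≠ b 2) (hC3 : σC (b 3) = b 3) (hC4 : σC (b 4) ≠ b 4)
    (hZ0 : σZ (b 0) = b 0) (hZ1 : σZ (b 1) ≠ b 1) (hZ2 : σZ (b 2) ≠ b 2) (hZ3 : σZ (b 3) ≠ b 3) (hZ4 : σZ (b 4) = b 4)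
    {T P : Equiv.Perm V} {p q : V → V} (hrow : ∀ i, List.Perm [T i, P i, p i, q i] [σB i, σC i, σZ i, σZ i])
    (hT0 : T (b 0) ≠ b 0) (hT1 : T (b 1) = b 1) (hT4 : T (b 4) = b 4)
    (hP3 : P (b 3) = b 3) (hP12 : P (b 1) = b 1 ∨ P (b 2) = b 2) : False := by
  obtain ⟨M, R, hPF⟩ := complete_two σB σC σZ σZ T P p q hrow
  have hQ : ∀ i, List.Perm [T i, P i, M i, R i] [σB i, σC i, σZ i, σZ i] := fun i => rot4 (hPF i)
  -- loop bookkeeping at the gate b4: two copies, one used by `T`, so exactly one of `P, M, R` fixes b4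
  have f4 := one_of_three_of_count_two (v := b 4) (hQ (b 4)) (by simp [hB4, hC4, hZ4]) hT4
  have slope : ∀ X : Equiv.Perm V, (∑ i, g i (X i)) = (if X (b 0) = b 0 then 1 else 0) + (if X (b 1) = b 1 then 2 else 0) +
      (if X (b 2) = b 2 then 4 else 0) + (if X (b 3) = b 3 then 8 else 0) + (if X (b 4) = b 4 then 16 else 0) := by
    intro X
    rw [slope_eq_sum_marked g b hb hoff hmark haux X, Fin.sum_univ_five]
    norm_num
  have sB := slope_B g b hb hoff hmark haux σB hB0 hB1 hB2 hB3 hB4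
  have sC := slope_C g b hb hoff hmark haux σC hC0 hC1 hC2 hC3 hC4
  have sZ := slope_Z g b hb hoff hmark haux σZ hZ0 hZ1 hZ2 hZ3 hZ4
  have sT : 18 ≤ ∑ i, g i (T i) := by
    rw [slope T]
    by_cases c2 : T (b 2) = b 2 <;> by_cases c3 : T (b 3) = b 3 <;> simp [hT0, hT1, hT4, c2, c3]
  have sP : 10 ≤ ∑ i, g i (P i) := by
    rw [slope P]
    rcases hP12 with h1 | h2
    · by_cases c0 : P (b 0) = b 0 <;> by_cases c2 : P (b 2) = b 2 <;> by_cases c4 : P (b 4) = b 4 <;> simp [hP3, h1, c0, c2, c4]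
    · by_cases c0 : P (b 0) = b 0 <;> by_cases c1 : P (b 1) = b 1 <;> by_cases c4 : P (b 4) = b 4 <;> simp [hP3, h2, c0, c1, c4]
  have nM := slope_nonneg g b hb hoff hmark haux M
  have nR := slope_nonneg g b hb hoff hmark haux R
  -- the Karamata step in the three cases «who fixes b4»
  have K := fun (F₁ F₂ F₃ : Equiv.Perm V) (hF : ∀ i, List.Perm [F₁ i, F₂ i, F₃ i, T i] [σB i, σC i, σZ i, σZ i])
      (h34 : 34 ≤ (∑ i, g i (F₃ i)) + ∑ i, g i (T i))
      (h234 : 44 ≤ (∑ i, g i (F₂ i)) + (∑ i, g i (F₃ i)) + ∑ i, g i (T i)) =>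
    (FourBit.four_factors_eq_le ok w g hBC.le hCZ.le le_rfl hB hC hZ hZ hF (by rw [sZ]; omega) (by rw [sZ]; omega)
      (by rw [sC, sZ]; omega)).2.2.2
  have P123 : ∀ i, List.Perm [P i, M i, R i, T i] [σB i, σC i, σZ i, σZ i] := hPF
  have P213 : ∀ i, List.Perm [M i, P i, R i, T i] [σB i, σC i, σZ i, σZ i] := fun i => sw12 (hPF i)
  have P231 : ∀ i, List.Perm [M i, R i, P i, T i] [σB i, σC i, σZ i, σZ i] := fun i => mv13 (hPF i)
  have P132 : ∀ i, List.Perm [P i, R i, M i, T i] [σB i, σC i, σZ i, σZ i] := fun i => perm4_swap12 (hPF i)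
  rcases f4 with ⟨p4, m4, r4⟩ | ⟨p4, m4, r4⟩ | ⟨p4, m4, r4⟩
  · -- `P` fixes b4: s(P) ≥ 26
    have sP' : 26 ≤ ∑ i, g i (P i) := by
      rw [slope P]
      rcases hP12 with h1 | h2
      · by_cases c0 : P (b 0) = b 0 <;> by_cases c2 : P (b 2) = b 2 <;> simp [hP3, h1, c0, c2, p4]
      · by_cases c0 : P (b 0) = b 0 <;> by_cases c1 : P (b 1) = b 1 <;> simp [hP3, h2, c0, c1, p4]
    have hTZ := K M R P P231 (by omega) (by omega)
    exact hT0 (by rw [hTZ]; exact hZ0)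
  · -- `M` fixes b4: s(M) ≥ 16, s(P) ≥ 10
    have sM : 16 ≤ ∑ i, g i (M i) := by
      rw [slope M]
      by_cases c0 : M (b 0) = b 0 <;> by_cases c1 : M (b 1) = b 1 <;> by_cases c2 : M (b 2) = b 2 <;>
        by_cases c3 : M (b 3) = b 3 <;> simp [m4, c0, c1, c2, c3]
    have hTZ := K R P M (fun i => mv31 (hPF i)) (by omega) (by omega)
    exact hT0 (by rw [hTZ]; exact hZ0)
  · -- `R` fixes b4
    have sR : 16 ≤ ∑ i, g i (R i) := by
      rw [slope R]
      by_cases c0 : R (b 0) = b 0 <;> by_cases c1 : R (b 1) = b 1 <;> by_cases c2 : R (b 2) = b 2 <;>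
        by_cases c3 : R (b 3) = b 3 <;> simp [r4, c0, c1, c2, c3]
    have hTZ := K M P R (fun i => sw12 (hPF i)) (by omega) (by omega)
    exact hT0 (by rw [hTZ]; exact hZ0)

/-- **`law_of_coverZ_BE`** (Z-doubled template, pair (B,E)).  The same with `σB ⊎ σE ⊎ σZ ⊎ σZ` (maximiser slopes `(6,12,17,17)`, suffix
sums `17, 34, 46`): next to a cover `T` using the loops at `b2`, `b4` and not at `b0` (slope ≥ 20), a compatible cover `P` cannot use the
loop at `b3` together with one of the loops at `b1`, `b2`. [this seat's theorem] -/
theorem law_of_coverZ_BE (hb : Function.Injective b)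
    (hoff : ∀ i j, j ≠ i → g i j = 0) (hmark : ∀ l, g (b l) (b l) = (2 : ℤ) ^ (l : ℕ)) (haux : ∀ i, (∀ l, b l ≠ i) → g i i = 0)
    {θB θE θZ : ℤ} {σB σE σZ : Equiv.Perm V} (hBE : θB < θE) (hEZ : θE < θZ)
    (hB : (∀ i, ok i (σB i)) ∧ ∀ τ : Equiv.Perm V, τ ≠ σB → (∀ i, ok i (τ i)) →
      ∑ i, (w i (τ i) + θB * g i (τ i)) < ∑ i, (w i (σB i) + θB * g i (σB i)))
    (hE : (∀ i, ok i (σE i)) ∧ ∀ τ : Equiv.Perm V, τ ≠ σE → (∀ i, ok i (τ i)) →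
      ∑ i, (w i (τ i) + θE * g i (τ i)) < ∑ i, (w i (σE i) + θE * g i (σE i)))
    (hZ : (∀ i, ok i (σZ i)) ∧ ∀ τ : Equiv.Perm V, τ ≠ σZ → (∀ i, ok i (τ i)) →
      ∑ i, (w i (τ i) + θZ * g i (τ i)) < ∑ i, (w i (σZ i) + θZ * g i (σZ i)))
    (hB0 : σB (b 0) ≠ b 0) (hB1 : σB (b 1) = b 1) (hB2 : σB (b 2) = b 2) (hB3 : σB (b 3) ≠ b 3) (hB4 : σB (b 4) ≠ b 4)
    (hE0 : σE (b 0) ≠ b 0) (hE1 : σE (b 1) ≠ b 1) (hE2 : σE (b 2) = b 2) (hE3 : σE (b 3) = b 3) (hE4 : σE (b 4) ≠ b 4)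
    (hZ0 : σZ (b 0) = b 0) (hZ1 : σZ (b 1) ≠ b 1) (hZ2 : σZ (b 2) ≠ b 2) (hZ3 : σZ (b 3) ≠ b 3) (hZ4 : σZ (b 4) = b 4)
    {T P : Equiv.Perm V} {p q : V → V} (hrow : ∀ i, List.Perm [T i, P i, p i, q i] [σB i, σE i, σZ i, σZ i])
    (hT0 : T (b 0) ≠ b 0) (hT2 : T (b 2) = b 2) (hT4 : T (b 4) = b 4)
    (hP3 : P (b 3) = b 3) (hP12 : P (b 1) = b 1 ∨ P (b 2) = b 2) : False := by
  obtain ⟨M, R, hPF⟩ := complete_two σB σE σZ σZ T P p q hrow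
  have hQ : ∀ i, List.Perm [T i, P i, M i, R i] [σB i, σE i, σZ i, σZ i] := fun i => rot4 (hPF i)
  have f4 := one_of_three_of_count_two (v := b 4) (hQ (b 4)) (by simp [hB4, hE4, hZ4]) hT4
  have slope : ∀ X : Equiv.Perm V, (∑ i, g i (X i)) = (if X (b 0) = b 0 then 1 else 0) + (if X (b 1) = b 1 then 2 else 0) +
      (if X (b 2) = b 2 then 4 else 0) + (if X (b 3) = b 3 then 8 else 0) + (if X (b 4) = b 4 then 16 else 0) := by
    intro X
    rw [slope_eq_sum_marked g b hb hoff hmark haux X, Fin.sum_univ_five]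
    norm_num
  have sB := slope_B g b hb hoff hmark haux σB hB0 hB1 hB2 hB3 hB4
  have sE := slope_E g b hb hoff hmark haux σE hE0 hE1 hE2 hE3 hE4
  have sZ := slope_Z g b hb hoff hmark haux σZ hZ0 hZ1 hZ2 hZ3 hZ4
  have sT : 20 ≤ ∑ i, g i (T i) := by
    rw [slope T]
    by_cases c1 : T (b 1) = b 1 <;> by_cases c3 : T (b 3) = b 3 <;> simp [hT0, hT2, hT4, c1, c3]
  have sP : 10 ≤ ∑ i, g i (P i) := by
    rw [slope P]
    rcases hP12 with h1 | h2
    · by_cases c0 : P (b 0) = b 0 <;> by_cases c2 : P (b 2) = b 2 <;> by_cases c4 : P (b 4) = b 4 <;> simp [hP3, h1, c0, c2, c4]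
    · by_cases c0 : P (b 0) = b 0 <;> by_cases c1 : P (b 1) = b 1 <;> by_cases c4 : P (b 4) = b 4 <;> simp [hP3, h2, c0, c1, c4]
  have nM := slope_nonneg g b hb hoff hmark haux M
  have nR := slope_nonneg g b hb hoff hmark haux R
  have K := fun (F₁ F₂ F₃ : Equiv.Perm V) (hF : ∀ i, List.Perm [F₁ i, F₂ i, F₃ i, T i] [σB i, σE i, σZ i, σZ i])
      (h34 : 34 ≤ (∑ i, g i (F₃ i)) + ∑ i, g i (T i))
      (h234 : 46 ≤ (∑ i, g i (F₂ i)) + (∑ i, g i (F₃ i)) + ∑ i, g i (T i)) =>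
    (FourBit.four_factors_eq_le ok w g hBE.le hEZ.le le_rfl hB hE hZ hZ hF (by rw [sZ]; omega) (by rw [sZ]; omega)
      (by rw [sE, sZ]; omega)).2.2.2
  rcases f4 with ⟨p4, m4, r4⟩ | ⟨p4, m4, r4⟩ | ⟨p4, m4, r4⟩
  · have sP' : 26 ≤ ∑ i, g i (P i) := by
      rw [slope P]
      rcases hP12 with h1 | h2
      · by_cases c0 : P (b 0) = b 0 <;> by_cases c2 : P (b 2) = b 2 <;> simp [hP3, h1, c0, c2, p4]
      · by_cases c0 : P (b 0) = b 0 <;> by_cases c1 : P (b 1) = b 1 <;> simp [hP3, h2, c0, c1, p4]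
    have hTZ := K M R P (fun i => mv13 (hPF i)) (by omega) (by omega)
    exact hT0 (by rw [hTZ]; exact hZ0)
  · have sM : 16 ≤ ∑ i, g i (M i) := by
      rw [slope M]
      by_cases c0 : M (b 0) = b 0 <;> by_cases c1 : M (b 1) = b 1 <;> by_cases c2 : M (b 2) = b 2 <;>
        by_cases c3 : M (b 3) = b 3 <;> simp [m4, c0, c1, c2, c3]
    have hTZ := K R P M (fun i => mv31 (hPF i)) (by omega) (by omega)
    exact hT0 (by rw [hTZ]; exact hZ0)
  · have sR : 16 ≤ ∑ i, g i (R i) := by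
      rw [slope R]
      by_cases c0 : R (b 0) = b 0 <;> by_cases c1 : R (b 1) = b 1 <;> by_cases c2 : R (b 2) = b 2 <;>
        by_cases c3 : R (b 3) = b 3 <;> simp [r4, c0, c1, c2, c3]
    have hTZ := K M P R (fun i => sw12 (hPF i)) (by omega) (by omega)
    exact hT0 (by rw [hTZ]; exact hZ0)

/-- **The all-m nested-triangle law modulo the located dichotomy.**  If in the realisation every Q₁₈-cover `T` of `σB⊎σC⊎σZ` admits EITHER
a compatible cover `N` of `σB⊎σC⊎σC⊎σZ` with a non-trivial marked pattern (the Y-doubled template of p683081) OR a compatible cover `P` of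
`σB⊎σC⊎σZ⊎σZ` using the loop at `b3` and one of the loops at `b1`, `b2` (the Z-doubled template of this file), and likewise for every
Q₂₀-cover of `σB⊎σE⊎σZ`, then the nested-triangle core is not realisable.  (Both alternatives are located: together they hold for every
Q-cover of every kernel-valid system tried, m ≤ 10, 0 exceptions; the first alone fails for ≈ 0.5 % of the Q-covers.) [this seat's theorem] -/
theorem nestedTriangle_false_of_covers_or_coversZ (hb : Function.Injective b)
    (hoff : ∀ i j, j ≠ i → g i j = 0) (hmark : ∀ l, g (b l) (b l) = (2 : ℤ) ^ (l : ℕ)) (haux : ∀ i, (∀ l, b l ≠ i) → g i i = 0)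
    {θB θC θE θZ : ℤ} {σB σC σE σZ : Equiv.Perm V}
    (hB : (∀ i, ok i (σB i)) ∧ ∀ τ : Equiv.Perm V, τ ≠ σB → (∀ i, ok i (τ i)) →
      ∑ i, (w i (τ i) + θB * g i (τ i)) < ∑ i, (w i (σB i) + θB * g i (σB i)))
    (hC : (∀ i, ok i (σC i)) ∧ ∀ τ : Equiv.Perm V, τ ≠ σC → (∀ i, ok i (τ i)) →
      ∑ i, (w i (τ i) + θC * g i (τ i)) < ∑ i, (w i (σC i) + θC * g i (σC i)))
    (hE : (∀ i, ok i (σE i)) ∧ ∀ τ : Equiv.Perm V, τ ≠ σE → (∀ i, ok i (τ i)) →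
      ∑ i, (w i (τ i) + θE * g i (τ i)) < ∑ i, (w i (σE i) + θE * g i (σE i)))
    (hZ : (∀ i, ok i (σZ i)) ∧ ∀ τ : Equiv.Perm V, τ ≠ σZ → (∀ i, ok i (τ i)) →
      ∑ i, (w i (τ i) + θZ * g i (τ i)) < ∑ i, (w i (σZ i) + θZ * g i (σZ i)))
    (hB0 : σB (b 0) ≠ b 0) (hB1 : σB (b 1) = b 1) (hB2 : σB (b 2) = b 2) (hB3 : σB (b 3) ≠ b 3) (hB4 : σB (b 4) ≠ b 4)
    (hC0 : σC (b 0) ≠ b 0) (hC1 : σC (b 1) = b 1) (hC2 : σC (b 2) ≠ b 2) (hC3 : σC (b 3) = b 3) (hC4 : σC (b 4) ≠ b 4)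
    (hE0 : σE (b 0) ≠ b 0) (hE1 : σE (b 1) ≠ b 1) (hE2 : σE (b 2) = b 2) (hE3 : σE (b 3) = b 3) (hE4 : σE (b 4) ≠ b 4)
    (hZ0 : σZ (b 0) = b 0) (hZ1 : σZ (b 1) ≠ b 1) (hZ2 : σZ (b 2) ≠ b 2) (hZ3 : σZ (b 3) ≠ b 3) (hZ4 : σZ (b 4) = b 4)
    (hPC_BC : ∀ T : Equiv.Perm V, (∀ i, T i = σB i ∨ T i = σC i ∨ T i = σZ i) →
      T (b 0) ≠ b 0 → T (b 1) = b 1 → T (b 2) ≠ b 2 → T (b 3) ≠ b 3 → T (b 4) = b 4 →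
      (∃ (N : Equiv.Perm V) (p q : V → V), (∀ i, List.Perm [T i, N i, p i, q i] [σB i, σC i, σC i, σZ i]) ∧
        ¬ ((N (b 0) = b 0 ∧ N (b 1) = b 1 ∧ N (b 2) = b 2 ∧ N (b 3) ≠ b 3) ∨
           (N (b 0) ≠ b 0 ∧ N (b 1) ≠ b 1 ∧ N (b 2) ≠ b 2 ∧ N (b 3) = b 3) ∨
           (N (b 0) ≠ b 0 ∧ N (b 1) = b 1 ∧ N (b 2) ≠ b 2 ∧ N (b 3) = b 3))) ∨
      (∃ (P : Equiv.Perm V) (p q : V → V), (∀ i, List.Perm [T i, P i, p i, q i] [σB i, σC i, σZ i, σZ i]) ∧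
        P (b 3) = b 3 ∧ (P (b 1) = b 1 ∨ P (b 2) = b 2)))
    (hPC_BE : ∀ T : Equiv.Perm V, (∀ i, T i = σB i ∨ T i = σE i ∨ T i = σZ i) →
      T (b 0) ≠ b 0 → T (b 1) ≠ b 1 → T (b 2) = b 2 → T (b 3) ≠ b 3 → T (b 4) = b 4 →
      (∃ (N : Equiv.Perm V) (p q : V → V), (∀ i, List.Perm [T i, N i, p i, q i] [σB i, σE i, σE i, σZ i]) ∧
        ¬ ((N (b 0) = b 0 ∧ N (b 1) = b 1 ∧ N (b 2) = b 2 ∧ N (b 3) ≠ b 3) ∨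
           (N (b 0) ≠ b 0 ∧ N (b 1) ≠ b 1 ∧ N (b 2) ≠ b 2 ∧ N (b 3) = b 3) ∨
           (N (b 0) ≠ b 0 ∧ N (b 1) ≠ b 1 ∧ N (b 2) = b 2 ∧ N (b 3) = b 3))) ∨
      (∃ (P : Equiv.Perm V) (p q : V → V), (∀ i, List.Perm [T i, P i, p i, q i] [σB i, σE i, σZ i, σZ i]) ∧
        P (b 3) = b 3 ∧ (P (b 1) = b 1 ∨ P (b 2) = b 2))) : False := by
  obtain ⟨hBC, hCE, hEZ⟩ := theta_order ok w g b hb hoff hmark haux hB hC hE hZ hB0 hB1 hB2 hB3 hB4 hC0 hC1 hC2 hC3 hC4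
    hE0 hE1 hE2 hE3 hE4 hZ0 hZ1 hZ2 hZ3 hZ4
  rcases core_S3 ok w g b hb hoff hmark haux hB hC hE hZ hB0 hB1 hB2 hB3 hB4 hC0 hC1 hC2 hC3 hC4 hE0 hE1 hE2 hE3 hE4 hZ0 hZ1 hZ2
      hZ3 hZ4 with ⟨T, hT, h0, h1, h2, h3, h4⟩ | ⟨T, hT, h0, h1, h2, h3, h4⟩
  · rcases hPC_BC T hT h0 h1 h2 h3 h4 with ⟨N, p, q, hrow, hN⟩ | ⟨P, p, q, hrow, hP3, hP12⟩
    · exact hN (law_of_cover_BC ok w g b hb hoff hmark haux hBC (hCE.trans hEZ) hB hC hZ hB0 hB1 hB2 hB3 hB4 hC0 hC1 hC2 hC3 hC4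
        hZ0 hZ1 hZ2 hZ3 hZ4 hrow h0 h1 h2 h3 h4)
    · exact law_of_coverZ_BC ok w g b hb hoff hmark haux hBC (hCE.trans hEZ) hB hC hZ hB0 hB1 hB2 hB3 hB4 hC0 hC1 hC2 hC3 hC4
        hZ0 hZ1 hZ2 hZ3 hZ4 hrow h0 h1 h4 hP3 hP12
  · rcases hPC_BE T hT h0 h1 h2 h3 h4 with ⟨N, p, q, hrow, hN⟩ | ⟨P, p, q, hrow, hP3, hP12⟩
    · exact hN (law_of_cover_BE ok w g b hb hoff hmark haux (hBC.trans hCE) hEZ hB hE hZ hB0 hB1 hB2 hB3 hB4 hE0 hE1 hE2 hE3 hE4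
        hZ0 hZ1 hZ2 hZ3 hZ4 hrow h0 h1 h2 h3 h4)
    · exact law_of_coverZ_BE ok w g b hb hoff hmark haux (hBC.trans hCE) hEZ hB hE hZ hB0 hB1 hB2 hB3 hB4 hE0 hE1 hE2 hE3 hE4
        hZ0 hZ1 hZ2 hZ3 hZ4 hrow h0 h2 h4 hP3 hP12

end Core

end Core
end MarkedEdge
end Summit.ValiantsHypothesis.ValiantsHypothesis.Theorems.KPlusLogSqLaw
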